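import Literature.NumberTheory.Automorphic.LocalPiSchwartzBruhatFourier
import HarnessLib

/-!
# A linear functional on `𝒮(F^ι)` invariant under all modulations is a multiple of evaluation at `0`

Topic `NumberTheory/Automorphic`; namespace `Literature.NumberTheory.Automorphic`.  KERNEL ONLY: theorems, 0 definitions,
0 records, 0 named facts, 0 `sorry`.

`F` a non-archimedean local field, `ι` finite, `ψ` a continuous non-trivial additive character.  The characters
`x ↦ ψ(⟨x, η⟩)`, `η ∈ F^ι`, act on the Schwartz–Bruhat space `𝒮(F^ι)` by multiplication («modulations»; in the
Schrödinger model of the Heisenberg group on `𝒮(X)` this is the action of the Lagrangian `Y`, tree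
`HeisenbergGroup.schrodingerSB`).  THEOREM (**`exists_eq_mul_eval_zero_of_modulation_invariant`**): a `ℂ`-linear
functional `Λ` on `𝒮(F^ι)` with `Λ(g) = Λ(f)` whenever `g = ψ(⟨·, η⟩) · f` for some `η` is `Λ(f) = c · f(0)` with
`c = Λ(1_{𝒪^ι})` — the coinvariants of `𝒮(F^ι)` under the modulations are ONE-dimensional, spanned by the image of
evaluation at `0` (dually: a distribution on `F^ι` invariant under multiplication by all unitary characters is a
multiple of `δ_0`).  Steps:

* `apply_indicator_vadd_eq_zero` (§1) — `Λ(1_{a+(𝔭^M)^ι}) = 0` for a coset NOT containing `0`: some coordinate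
  `a_i ∉ 𝔭^M`, the conductor of `ψ` gives `y ∈ 𝔭^{m-M}` with `ζ = ψ(a_i y) ≠ 1`
  (`exists_mem_primePowBall_addChar_mul_ne_one`), and the modulation by `η = y e_i` multiplies `1_{a+(𝔭^M)^ι}` by the
  CONSTANT `ζ`, so `ζ Λ(1_B) = Λ(1_B)`;
* `apply_eq_zero_of_apply_zero_eq_zero` (§2) — `Λ(f) = 0` if `f(0) = 0`: `f` is `(𝔭^M)^ι`-invariant for some `M`, hence
  vanishes on `(𝔭^M)^ι` and is a finite combination of indicators of cosets of `(𝔭^M)^ι` not containing `0`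
  ([WeilBNT1967, Ch. VII §2, Prop. 2], tree `exists_finset_eq_sum_const_mul_indicator_pi_of_forall_add_eq`);
* §3 the theorem, with `c = Λ(1_{(𝔭^0)^ι})`.

This is the uniqueness, up to scalar, of the `ρ(Y)`-invariant functional («evaluation at the origin») on the
Schrödinger model attached to a polarisation `X ⊕ Y` ([MoeglinVignerasWaldspurger1987, Chap. 2 II.6]; dual to the
uniqueness of Haar measure as the translation-invariant functional).  Written for the cell `hodgecm-mathlib` (fan B,
rung B-IV, KEY `b4-howe-compact-irreducible`, node E5 of the doubling proof of
`MoeglinVignerasWaldspurger1987.mvw_IV4_rankOne_irreducibleOrZero`: it identifies the transport of «evaluation at 0» from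
the `ℓ_Δ`-model of the doubled Weil representation with the canonical pairing `∫ f₁ f₂` on `𝒮(X) ⊗ 𝒮(X)`).  Nothing
about theta lifts is asserted here.

## References
* [WeilBNT1967] A. Weil, *Basic Number Theory* (1967), Chap. VII §2, Prop. 2 (structure of standard functions);
  Chap. II §5 Prop. 12 (dual lattices / conductor).
* [MoeglinVignerasWaldspurger1987] C. Mœglin, M.-F. Vignéras, J.-L. Waldspurger, LNM 1291 (1987), Chap. 2 I.3, II.6.
-/

set_option autoImplicit false

noncomputable section

open _root_.Set Function
open scoped Pointwise

namespace Literature.NumberTheory.Automorphic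

open Literature.NumberTheory.GaloisRepresentations.IsNonarchimedeanLocalField

variable {F : Type*} [Field F] [ValuativeRel F] [TopologicalSpace F] [IsNonarchimedeanLocalField F]
  {ι : Type*} [Fintype ι] [DecidableEq ι] {ψ : AddChar F Circle} {m : ℤ}
  (Λ : SchwartzBruhat (ι → F) →ₗ[ℂ] ℂ)
  (hΛ : ∀ (η : ι → F) (f g : SchwartzBruhat (ι → F)),
    (∀ x, (g : (ι → F) → ℂ) x = ((ψ (x ⬝ᵥ η) : Circle) : ℂ) * (f : (ι → F) → ℂ) x) → Λ g = Λ f)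

/-! ## §1 Indicators of cosets not containing `0` are killed -/

include hΛ in
/-- **`Λ(1_{a + (𝔭^M)^ι}) = 0` when `a ∉ (𝔭^M)^ι`** (i.e. `0 ∉ a + (𝔭^M)^ι`): a modulation by `η = y e_i` with
`y ∈ 𝔭^{m-M}`, `ψ(a_i y) ≠ 1` multiplies the indicator by the constant `ψ(a_i y)`.
[cite: WeilBNT1967, Ch. II §5, Prop. 12] -/
theorem apply_indicator_vadd_eq_zero (hm : ψ.HasConductorExp m) {M : ℤ} {a : ι → F}
    (ha : a ∉ piPrimePowBall F ι M) :
    Λ ⟨(a +ᵥ piPrimePowBall F ι M).indicator fun _ => (1 : ℂ), indicator_vadd_piPrimePowBall_mem_schwartzBruhat M a 1⟩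
      = 0 := by
  -- a coordinate `a_i ∉ 𝔭^M` and `y ∈ 𝔭^{m-M}` with `ψ(y a_i) ≠ 1`
  rw [mem_piPrimePowBall_iff] at ha
  push Not at ha
  obtain ⟨i, hi⟩ := ha
  have hi' : a i ∉ primePowBall F (m - (m - M)) := by rwa [sub_sub_cancel]
  obtain ⟨y, hy, hne⟩ := exists_mem_primePowBall_addChar_mul_ne_one hm hi'
  set ζ : ℂ := ((ψ (a i * y) : Circle) : ℂ) with hζ
  have hζ1 : ζ ≠ 1 := by
    rw [hζ, mul_comm]
    intro h
    apply hne
    apply Subtype.ext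
    rw [Circle.coe_one]
    exact h
  -- the modulated indicator is `ζ • 1_B`
  set B := a +ᵥ piPrimePowBall F ι M with hB
  let f : SchwartzBruhat (ι → F) := ⟨B.indicator fun _ => (1 : ℂ), indicator_vadd_piPrimePowBall_mem_schwartzBruhat M a 1⟩
  have key := hΛ (Pi.single i y) f (ζ • f) fun x => by
    change ζ * B.indicator (fun _ => (1 : ℂ)) x = _ * B.indicator (fun _ => (1 : ℂ)) x
    by_cases hx : x ∈ B
    · -- on `B`: `x ⬝ᵥ η = x_i y = a_i y + (x_i - a_i) y` and `(x_i - a_i) y ∈ 𝔭^m`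
      rw [dotProduct_single]
      obtain ⟨t, ht, rfl⟩ := Set.mem_vadd_set.1 hx
      have hti : (t i) * y ∈ primePowBall F m := by
        have := mul_mem_primePowBall (mem_piPrimePowBall_iff.1 ht i) hy
        rwa [add_sub_cancel] at this
      rw [vadd_eq_add, Pi.add_apply, add_mul, AddChar.map_add_eq_mul, Circle.coe_mul, hm.1 _ hti, Circle.coe_one,
        mul_one]
    · rw [Set.indicator_of_notMem hx, mul_zero, mul_zero]
  rw [map_smul, smul_eq_mul] at key
  -- `ζ Λ(1_B) = Λ(1_B)` with `ζ ≠ 1`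
  have h0 : (ζ - 1) * Λ f = 0 := by rw [sub_mul, one_mul, key, sub_self]
  rcases mul_eq_zero.1 h0 with h | h
  · exact absurd (sub_eq_zero.1 h) hζ1
  · exact h

/-! ## §2 Functions vanishing at `0` are killed -/

include hΛ in
/-- **`Λ(f) = 0` if `f(0) = 0`**: `f` vanishes on a box `(𝔭^M)^ι` and is a finite combination of indicators of cosets
of `(𝔭^M)^ι` avoiding `0`. [cite: WeilBNT1967, Ch. VII §2, Prop. 2] -/
theorem apply_eq_zero_of_apply_zero_eq_zero (hm : ψ.HasConductorExp m) (f : SchwartzBruhat (ι → F))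
    (hf0 : (f : (ι → F) → ℂ) 0 = 0) : Λ f = 0 := by
  classical
  obtain ⟨M, hM⟩ := exists_forall_add_eq_of_mem_schwartzBruhat_pi f.2
  obtain ⟨C, rep, hrep, hsum⟩ := exists_finset_eq_sum_const_mul_indicator_pi_of_forall_add_eq f.2 hM
  -- `f = Σ_B f(rep B) • 1_B` in `𝒮(F^ι)`
  have hfeq : f = ∑ B ∈ C, ((f : (ι → F) → ℂ) (rep B)) •
      (⟨(rep B +ᵥ piPrimePowBall F ι M).indicator fun _ => (1 : ℂ),
        indicator_vadd_piPrimePowBall_mem_schwartzBruhat M (rep B) 1⟩ : SchwartzBruhat (ι → F)) := by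
    apply Subtype.ext
    funext u
    rw [hsum u, Submodule.coe_sum, Finset.sum_apply]
    refine Finset.sum_congr rfl fun B hB => ?_
    rw [Submodule.coe_smul, Pi.smul_apply, smul_eq_mul]
    congr 1
    change B.indicator (fun _ => (1 : ℂ)) u = (rep B +ᵥ piPrimePowBall F ι M).indicator (fun _ => (1 : ℂ)) u
    rw [← hrep B hB]
  rw [hfeq, map_sum]
  refine Finset.sum_eq_zero fun B hB => ?_
  rw [map_smul, smul_eq_mul]
  by_cases hrepB : rep B ∈ piPrimePowBall F ι M
  · -- `f(rep B) = f(0 + rep B) = f(0) = 0`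
    have : (f : (ι → F) → ℂ) (rep B) = 0 := by
      have h := hM 0 (rep B) hrepB
      rw [zero_add] at h
      rw [h, hf0]
    rw [this, zero_mul]
  · rw [apply_indicator_vadd_eq_zero Λ hΛ hm hrepB, mul_zero]

/-! ## §3 The functional is a multiple of evaluation at `0` -/

include hΛ in
/-- **A modulation-invariant linear functional on `𝒮(F^ι)` is `c · ev₀`**, `c = Λ(1_{𝒪^ι})`: the modulation
coinvariants of `𝒮(F^ι)` are one-dimensional. [cite: MoeglinVignerasWaldspurger1987, Chap. 2 II.6] -/
theorem exists_eq_mul_eval_zero_of_modulation_invariant (hψ : ψ.IsContinuousNontrivial) :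
    ∃ c : ℂ, ∀ f : SchwartzBruhat (ι → F), Λ f = c * (f : (ι → F) → ℂ) 0 := by
  obtain ⟨m, hm⟩ := hψ.exists_hasConductorExp
  let e : SchwartzBruhat (ι → F) :=
    ⟨(piPrimePowBall F ι 0).indicator fun _ => (1 : ℂ), indicator_piPrimePowBall_mem_schwartzBruhat 0 1⟩
  refine ⟨Λ e, fun f => ?_⟩
  -- `f - f(0) • e` vanishes at `0`
  have h0 : ((f - (f : (ι → F) → ℂ) 0 • e : SchwartzBruhat (ι → F)) : (ι → F) → ℂ) 0 = 0 := by
    rw [Submodule.coe_sub, Submodule.coe_smul, Pi.sub_apply, Pi.smul_apply, smul_eq_mul]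
    change (f : (ι → F) → ℂ) 0 - (f : (ι → F) → ℂ) 0 * (piPrimePowBall F ι 0).indicator (fun _ => (1 : ℂ)) 0 = 0
    rw [Set.indicator_of_mem (zero_mem_piPrimePowBall 0), mul_one, sub_self]
  have h := apply_eq_zero_of_apply_zero_eq_zero Λ hΛ hm _ h0
  rw [map_sub, map_smul, smul_eq_mul, sub_eq_zero] at h
  rw [h, mul_comm]

end Literature.NumberTheory.Automorphic

end
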